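import Summits.AtomisticToContinuum.HydrodynamicLimit.Theorems.AntiMazurCoboundariesKineticFluxLdDecayProductionContinuityPrelim
import Summits.AtomisticToContinuum.HydrodynamicLimit.Theorems.AntiMazurCoboundariesKineticFluxLdDecayHTheoremObjectsE
import Literature.Probability.Divergences.HellingerKullback
import HarnessLib

/-!
# Continuity of the cut Hellinger production at the local Maxwellian (crux `KineticFluxLdDecay`,
# stmt-AtomisticToContinuum-10967) — registered stub `stub_productionContinuity` (objects part E)

In the frame of `Theorems/AntiMazurCoboundariesKineticFluxLdDecayHTheoremObjects.lean` (statement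
`HTheorem.ProductionContinuity` of `…HTheoremObjectsE.lean`): for every cut level `K ≥ 0`, second-moment bound
`M ≥ 0` and `ε > 0` there is `η > 0` such that every one-body probability law `f ≪ m = vol ⊗ γ` on `𝕋³ × ℝ³` with
`∫ ‖w‖² df ≤ M` and `KL(f ‖ f₁ ⊗ γ) ≤ η` has cut production `𝒟(1_{n ≤ K} df/dm) ≤ ε`.

Proof (fibrewise lemmas in `…ProductionContinuityPrelim.lean`; `ρ = df/dm`, `n = ∫ ρ dγ = df₁/dvol` a.e.,
`ζ = √ρ - √n`, `H_x = ∫ ζ² dγ ≤ 2n`, truncation level `R > 0`):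

* the kept-fibre bound `stub_productionContinuityPrelim` of the preliminaries (helper file 1 of 2; `c² = n ≤ K`):
  `P_x ≤ 8|S²| K [(3R + m_γ) H_x + R⁻¹ (4 ∫ ‖w‖² ρ(x, ·) dγ + 2 K m₂,γ)]`
  (`m_γ = ∫ ‖w‖ dγ`, `m₂,γ = ∫ ‖w‖² dγ`, finite Gaussian moments: `lintegral_enorm(_sq)_stdGaussian_ne_top`);
* `production_cut_le` — integrate in `x` (`vol 𝕋³ = 1`): `∫ H_x dx ≤ KL(f ‖ f₁ ⊗ γ)`
  (`Literature.Probability.Divergences.lintegral_sqrt_rnDeriv_sub_sqrt_fst_sq_le_klDiv`) and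
  `∫ dx ∫ ‖w‖² ρ dγ = ∫ ‖w‖² df`, whence
  `𝒟(cut) ≤ 8|S²|K(3R + m_γ) KL + 8|S²|K (4/R) ∫ ‖w‖² df + 8|S²|K · 2K m₂,γ / R`;
* `stub_productionContinuity` — choose `R` with the `R⁻¹`-terms `≤ ε/2`, then `η`.

Reference: C. Cercignani, R. Illner, M. Pulvirenti, *The Mathematical Theory of Dilute Gases* (1994), §3.1.
-/

noncomputable section

open MeasureTheory ProbabilityTheory Set Filter
open scoped ENNReal

namespace Summit.AtomisticToContinuum.HydrodynamicLimit.Theorems.HTheorem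

open Literature.MathematicalPhysics.KineticTheory (T3 V3 sphereMeasure)
open Literature.Analysis.FluidPDE (isFiniteMeasure_sphereMeasure)
open Literature.Analysis.UnboundedOperators (collisionDensity)

namespace CutProductionContinuity

/-! ### Gaussian moments and the second-moment disintegration -/

/-- The first absolute moment of the standard Gaussian on `ℝ³` is finite. -/
theorem lintegral_enorm_stdGaussian_ne_top : ∫⁻ w, ‖w‖ₑ ∂stdGaussian V3 ≠ ⊤ :=
  (IsGaussian.integrable_id (μ := stdGaussian V3)).hasFiniteIntegral.ne

/-- The second moment of the standard Gaussian on `ℝ³` is finite. -/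
theorem lintegral_enorm_sq_stdGaussian_ne_top : ∫⁻ w, ‖w‖ₑ ^ 2 ∂stdGaussian V3 ≠ ⊤ := by
  have h : Integrable (fun w : V3 => ‖w‖ ^ 2) (stdGaussian V3) :=
    (memLp_two_iff_integrable_sq_norm aestronglyMeasurable_id).1 IsGaussian.memLp_two_id
  refine ne_of_lt (lt_of_eq_of_lt (lintegral_congr fun w => ?_) h.hasFiniteIntegral)
  rw [Real.enorm_eq_ofReal (sq_nonneg _), ENNReal.ofReal_pow (norm_nonneg _), ofReal_norm]

/-- `∫ dx ∫ ‖w‖² (df/dm)(x, w) γ(dw) = ∫ ‖w‖² df` for `f ≪ m = vol ⊗ γ` finite. -/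
theorem lintegral_lintegral_enorm_sq_mul_rnDeriv (f : Measure (T3 × V3)) [IsFiniteMeasure f]
    (hac : f ≪ refMeasure) :
    ∫⁻ x, ∫⁻ w, ‖w‖ₑ ^ 2 * f.rnDeriv refMeasure (x, w) ∂stdGaussian V3 = ∫⁻ y, ‖y.2‖ₑ ^ 2 ∂f := by
  haveI : SigmaFinite refMeasure := by
    change SigmaFinite ((volume : Measure T3).prod (stdGaussian V3)); infer_instance
  have hφ : Measurable (f.rnDeriv refMeasure) := Measure.measurable_rnDeriv _ _
  have h2 : Measurable fun y : T3 × V3 => ‖y.2‖ₑ ^ 2 := measurable_snd.enorm.pow_const _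
  have hm : Measurable fun y : T3 × V3 => ‖y.2‖ₑ ^ 2 * f.rnDeriv refMeasure y := h2.mul hφ
  calc ∫⁻ x, ∫⁻ w, ‖w‖ₑ ^ 2 * f.rnDeriv refMeasure (x, w) ∂stdGaussian V3
      = ∫⁻ y, ‖y.2‖ₑ ^ 2 * f.rnDeriv refMeasure y ∂refMeasure := by
        unfold refMeasure
        exact (lintegral_prod _ hm.aemeasurable).symm
    _ = ∫⁻ y, ‖y.2‖ₑ ^ 2 ∂(refMeasure.withDensity (f.rnDeriv refMeasure)) := by
        rw [lintegral_withDensity_eq_lintegral_mul _ hφ h2]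
        refine lintegral_congr fun y => ?_
        simp only [Pi.mul_apply]
        ring
    _ = ∫⁻ y, ‖y.2‖ₑ ^ 2 ∂f := by rw [Measure.withDensity_rnDeriv_eq f refMeasure hac]

/-! ### The cut production bound -/

/-- **Quantitative cut production bound.** For a one-body probability law `f ≪ vol ⊗ γ`, a cut level `K ≥ 0`
and a truncation level `R > 0`,
`𝒟(1_{n ≤ K} df/dm) ≤ 8|S²|K(3R + m_γ) · KL(f ‖ f₁ ⊗ γ) + 8|S²|K(4/R) · ∫ ‖w‖² df + 8|S²|K · 2K m₂,γ/R`. -/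
theorem production_cut_le (f : Measure (T3 × V3)) [IsProbabilityMeasure f] (hac : f ≪ refMeasure) {K : ℝ}
    (hK : 0 ≤ K) {R : ℝ} (hR : 0 < R) :
    production (Set.indicator ({x | (f.fst.rnDeriv volume x).toReal ≤ K} ×ˢ Set.univ)
        (fun y => (f.rnDeriv refMeasure y).toReal)) ≤
      ENNReal.ofReal (8 * (sphereMeasure (Set.univ : Set (Metric.sphere (0 : V3) 1))).toReal * K *
          (3 * R + (∫⁻ w, ‖w‖ₑ ∂stdGaussian V3).toReal)) * velKL f +
        ENNReal.ofReal (8 * (sphereMeasure (Set.univ : Set (Metric.sphere (0 : V3) 1))).toReal * K *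
          (4 * R⁻¹)) * ∫⁻ y, ‖y.2‖ₑ ^ 2 ∂f +
        ENNReal.ofReal (8 * (sphereMeasure (Set.univ : Set (Metric.sphere (0 : V3) 1))).toReal * K *
          (R⁻¹ * (2 * (K * (∫⁻ w, ‖w‖ₑ ^ 2 ∂stdGaussian V3).toReal)))) := by
  haveI hT3 : IsProbabilityMeasure (volume : Measure T3) := ⟨by rw [volume_pi, Measure.pi_univ]; simp⟩
  haveI := isFiniteMeasure_sphereMeasure (E := V3)
  set γ : Measure V3 := stdGaussian V3 with hγ
  set s₂ : ℝ≥0∞ := sphereMeasure (Set.univ : Set (Metric.sphere (0 : V3) 1)) with hs₂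
  set mγ : ℝ≥0∞ := ∫⁻ w, ‖w‖ₑ ∂γ with hmγ
  set m2γ : ℝ≥0∞ := ∫⁻ w, ‖w‖ₑ ^ 2 ∂γ with hm2γ
  set Kₑ : ℝ≥0∞ := ENNReal.ofReal K with hKₑ
  have hφ : Measurable (f.rnDeriv refMeasure) := Measure.measurable_rnDeriv _ _
  set φ₁ : T3 → ℝ≥0∞ := fun x => ∫⁻ w, f.rnDeriv refMeasure (x, w) ∂γ with hφ₁def
  have hφ₁ : Measurable φ₁ := hφ.lintegral_prod_right'
  set H : T3 → ℝ≥0∞ := fun x => ∫⁻ w, ENNReal.ofReal ((Real.sqrt (f.rnDeriv refMeasure (x, w)).toReal -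
    Real.sqrt (f.fst.rnDeriv volume x).toReal) ^ 2) ∂γ with hHdef
  have hHm : Measurable H := by
    have hF : Measurable fun p : T3 × V3 => ENNReal.ofReal ((Real.sqrt (f.rnDeriv refMeasure (p.1, p.2)).toReal -
        Real.sqrt (f.fst.rnDeriv volume p.1).toReal) ^ 2) := by
      exact ((hφ.ennreal_toReal.sqrt).sub
        ((Measure.measurable_rnDeriv _ _).ennreal_toReal.sqrt.comp measurable_fst)).pow_const _
          |>.ennreal_ofReal
    exact hF.lintegral_prod_right'
  set M2 : T3 → ℝ≥0∞ := fun x => ∫⁻ w, ‖w‖ₑ ^ 2 * f.rnDeriv refMeasure (x, w) ∂γ with hM2def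
  have hM2m : Measurable M2 := by
    have hF : Measurable fun p : T3 × V3 => ‖p.2‖ₑ ^ 2 * f.rnDeriv refMeasure p :=
      (measurable_snd.enorm.pow_const _).mul hφ
    exact hF.lintegral_prod_right'
  -- a.e. identification of the position density with `φ₁`
  have hae : ∀ᵐ x ∂(volume : Measure T3), f.fst.rnDeriv volume x = φ₁ x := by
    rw [CutProduction.fst_eq_withDensity f hac]
    exact Measure.rnDeriv_withDensity _ hφ₁
  have hlt : ∀ᵐ x ∂(volume : Measure T3), f.fst.rnDeriv volume x < ⊤ := Measure.rnDeriv_lt_top _ _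
  -- fibrewise bound
  have hfib : ∀ᵐ x ∂(volume : Measure T3),
      ∫⁻ q, ENNReal.ofReal (collisionDensity q * hellingerDefect (fun w =>
          Set.indicator ({x | (f.fst.rnDeriv volume x).toReal ≤ K} ×ˢ (Set.univ : Set V3))
            (fun y => (f.rnDeriv refMeasure y).toReal) (x, w)) q ^ 2) ∂collMeasure ≤
        8 * s₂ * (Kₑ * ((3 * ENNReal.ofReal R + mγ) * H x +
          ENNReal.ofReal R⁻¹ * (4 * M2 x + 2 * (Kₑ * m2γ)))) := by
    filter_upwards [hae, hlt] with x hx hxlt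
    by_cases hxE : (f.fst.rnDeriv volume x).toReal ≤ K
    · have hsec : (fun w => Set.indicator ({x | (f.fst.rnDeriv volume x).toReal ≤ K} ×ˢ (Set.univ : Set V3))
          (fun y => (f.rnDeriv refMeasure y).toReal) (x, w)) =
          fun w => (f.rnDeriv refMeasure (x, w)).toReal := by
        funext w
        exact Set.indicator_of_mem
          (show (x, w) ∈ {x | (f.fst.rnDeriv volume x).toReal ≤ K} ×ˢ (Set.univ : Set V3) from
            ⟨hxE, Set.mem_univ _⟩) _
      rw [hsec]
      have hK' : φ₁ x ≤ Kₑ := by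
        rw [← hx, ← ENNReal.ofReal_toReal hxlt.ne]
        exact ENNReal.ofReal_le_ofReal hxE
      have hcK : ENNReal.ofReal (Real.sqrt (f.fst.rnDeriv volume x).toReal ^ 2) ≤ Kₑ := by
        rw [Real.sq_sqrt ENNReal.toReal_nonneg]
        exact ENNReal.ofReal_le_ofReal hxE
      exact stub_productionContinuityPrelim (fun w => f.rnDeriv refMeasure (x, w)) _ R Kₑ (hφ.comp measurable_prodMk_left)
        (Real.sqrt_nonneg _) hR hK' hcK
    · have hsec : (fun w => Set.indicator ({x | (f.fst.rnDeriv volume x).toReal ≤ K} ×ˢ (Set.univ : Set V3))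
          (fun y => (f.rnDeriv refMeasure y).toReal) (x, w)) = fun _ => (0 : ℝ) := by
        funext w
        exact Set.indicator_of_notMem
          (show (x, w) ∉ {x | (f.fst.rnDeriv volume x).toReal ≤ K} ×ˢ (Set.univ : Set V3) from
            fun h => hxE h.1) _
      rw [hsec]
      simp [hellingerDefect]
  -- integrate in `x`
  have hHle : ∫⁻ x, H x ≤ velKL f :=
    Literature.Probability.Divergences.lintegral_sqrt_rnDeriv_sub_sqrt_fst_sq_le_klDiv volume γ f hac
  have hM2 : ∫⁻ x, M2 x = ∫⁻ y, ‖y.2‖ₑ ^ 2 ∂f := lintegral_lintegral_enorm_sq_mul_rnDeriv f hac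
  have h1 : Measurable fun x => 4 * M2 x + 2 * (Kₑ * m2γ) := (hM2m.const_mul _).add measurable_const
  have h2 : Measurable fun x => (3 * ENNReal.ofReal R + mγ) * H x := hHm.const_mul _
  have h3 : Measurable fun x => ENNReal.ofReal R⁻¹ * (4 * M2 x + 2 * (Kₑ * m2γ)) := h1.const_mul _
  have h4 : Measurable fun x => (3 * ENNReal.ofReal R + mγ) * H x +
      ENNReal.ofReal R⁻¹ * (4 * M2 x + 2 * (Kₑ * m2γ)) := h2.add h3
  have h5 : Measurable fun x => Kₑ * ((3 * ENNReal.ofReal R + mγ) * H x +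
      ENNReal.ofReal R⁻¹ * (4 * M2 x + 2 * (Kₑ * m2γ))) := h4.const_mul _
  have hint : ∫⁻ x, 8 * s₂ * (Kₑ * ((3 * ENNReal.ofReal R + mγ) * H x +
      ENNReal.ofReal R⁻¹ * (4 * M2 x + 2 * (Kₑ * m2γ)))) =
      8 * s₂ * (Kₑ * ((3 * ENNReal.ofReal R + mγ) * (∫⁻ x, H x) +
        ENNReal.ofReal R⁻¹ * (4 * (∫⁻ x, M2 x) + 2 * (Kₑ * m2γ)))) := by
    rw [lintegral_const_mul _ h5, lintegral_const_mul _ h4, lintegral_add_left h2, lintegral_const_mul _ hHm,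
      lintegral_const_mul _ h1, lintegral_add_left (hM2m.const_mul _), lintegral_const_mul _ hM2m,
      lintegral_const, measure_univ, mul_one]
  -- the constants are finite
  have hs₂t : s₂ ≠ ⊤ := measure_ne_top _ _
  have hmγt : mγ ≠ ⊤ := lintegral_enorm_stdGaussian_ne_top
  have hm2γt : m2γ ≠ ⊤ := lintegral_enorm_sq_stdGaussian_ne_top
  have hs0 : 0 ≤ s₂.toReal := ENNReal.toReal_nonneg
  have ha0 : 0 ≤ mγ.toReal := ENNReal.toReal_nonneg
  have hb0 : 0 ≤ m2γ.toReal := ENNReal.toReal_nonneg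
  have e1 : ENNReal.ofReal (8 * s₂.toReal * K * (3 * R + mγ.toReal)) =
      8 * s₂ * Kₑ * (3 * ENNReal.ofReal R + mγ) := by
    rw [ENNReal.ofReal_mul (by positivity), ENNReal.ofReal_mul (by positivity),
      ENNReal.ofReal_mul (by norm_num), ENNReal.ofReal_add (by positivity) ha0,
      ENNReal.ofReal_mul (by norm_num), ENNReal.ofReal_ofNat, ENNReal.ofReal_ofNat,
      ENNReal.ofReal_toReal hs₂t, ENNReal.ofReal_toReal hmγt]
  have e2 : ENNReal.ofReal (8 * s₂.toReal * K * (4 * R⁻¹)) = 8 * s₂ * Kₑ * (4 * ENNReal.ofReal R⁻¹) := by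
    rw [ENNReal.ofReal_mul (by positivity), ENNReal.ofReal_mul (by positivity),
      ENNReal.ofReal_mul (by norm_num), ENNReal.ofReal_mul (by norm_num), ENNReal.ofReal_ofNat,
      ENNReal.ofReal_ofNat, ENNReal.ofReal_toReal hs₂t]
  have e3 : ENNReal.ofReal (8 * s₂.toReal * K * (R⁻¹ * (2 * (K * m2γ.toReal)))) =
      8 * s₂ * Kₑ * (ENNReal.ofReal R⁻¹ * (2 * (Kₑ * m2γ))) := by
    rw [ENNReal.ofReal_mul (by positivity), ENNReal.ofReal_mul (by positivity),
      ENNReal.ofReal_mul (by norm_num), ENNReal.ofReal_mul (by positivity), ENNReal.ofReal_mul (by norm_num),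
      ENNReal.ofReal_mul hK, ENNReal.ofReal_ofNat, ENNReal.ofReal_ofNat, ENNReal.ofReal_toReal hs₂t,
      ENNReal.ofReal_toReal hm2γt]
  calc production (Set.indicator ({x | (f.fst.rnDeriv volume x).toReal ≤ K} ×ˢ Set.univ)
        (fun y => (f.rnDeriv refMeasure y).toReal))
      ≤ ∫⁻ x, 8 * s₂ * (Kₑ * ((3 * ENNReal.ofReal R + mγ) * H x +
          ENNReal.ofReal R⁻¹ * (4 * M2 x + 2 * (Kₑ * m2γ)))) := lintegral_mono_ae hfib
    _ = _ := hint
    _ ≤ 8 * s₂ * (Kₑ * ((3 * ENNReal.ofReal R + mγ) * velKL f +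
          ENNReal.ofReal R⁻¹ * (4 * ∫⁻ y, ‖y.2‖ₑ ^ 2 ∂f + 2 * (Kₑ * m2γ)))) := by
        rw [hM2]
        gcongr
    _ = _ := by
        rw [e1, e2, e3]
        ring

end CutProductionContinuity

open CutProductionContinuity in
/-- **Stub `stub_productionContinuity`** (registered signature): the cut Hellinger production is continuous at
the local Maxwellian in the entropy + second-moment topology. Given `K, M, ε`, take the truncation level
`R = 2D/ε + 1` with `D = 8|S²|K(4M + 2K m₂,γ)` (so that the `R⁻¹`-terms of `production_cut_le` are `≤ ε/2`)
and then `η = ε / (2(A + 1))` with `A = 8|S²|K(3R + m_γ)`. -/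
theorem stub_productionContinuity : ProductionContinuity := by
  intro K hK M hM ε hε
  haveI := isFiniteMeasure_sphereMeasure (E := V3)
  set s : ℝ := (sphereMeasure (Set.univ : Set (Metric.sphere (0 : V3) 1))).toReal with hs
  set a : ℝ := (∫⁻ w, ‖w‖ₑ ∂stdGaussian V3).toReal with ha
  set b : ℝ := (∫⁻ w, ‖w‖ₑ ^ 2 ∂stdGaussian V3).toReal with hb
  have hs0 : 0 ≤ s := ENNReal.toReal_nonneg
  have ha0 : 0 ≤ a := ENNReal.toReal_nonneg
  have hb0 : 0 ≤ b := ENNReal.toReal_nonneg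
  -- the truncation level
  set D : ℝ := 8 * s * K * (4 * M + 2 * (K * b)) with hD
  have hD0 : 0 ≤ D := by positivity
  set R : ℝ := 2 * D / ε + 1 with hRdef
  have hR : 0 < R := by positivity
  have hDR : D * R⁻¹ ≤ ε / 2 := by
    rw [← div_eq_mul_inv, div_le_iff₀ hR]
    have h : ε / 2 * R = D + ε / 2 := by
      rw [hRdef]
      field_simp
    rw [h]
    linarith
  -- the entropy threshold
  set A : ℝ := 8 * s * K * (3 * R + a) with hA
  have hA0 : 0 ≤ A := by positivity
  set η : ℝ := ε / (2 * (A + 1)) with hηdef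
  have hη : 0 < η := by positivity
  have hAη : A * η ≤ ε / 2 := by
    rw [hηdef, mul_div_assoc', div_le_iff₀ (by positivity)]
    nlinarith
  refine ⟨η, hη, fun f hf hac hM2 hKL => ?_⟩
  have hcoef : 8 * s * K * (4 * R⁻¹) * M + 8 * s * K * (R⁻¹ * (2 * (K * b))) = D * R⁻¹ := by
    rw [hD]
    ring
  calc production (Set.indicator ({x | (f.fst.rnDeriv volume x).toReal ≤ K} ×ˢ Set.univ)
        (fun y => (f.rnDeriv refMeasure y).toReal))
      ≤ ENNReal.ofReal A * velKL f + ENNReal.ofReal (8 * s * K * (4 * R⁻¹)) * ∫⁻ y, ‖y.2‖ₑ ^ 2 ∂f +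
          ENNReal.ofReal (8 * s * K * (R⁻¹ * (2 * (K * b)))) := production_cut_le f hac hK hR
    _ ≤ ENNReal.ofReal A * ENNReal.ofReal η + ENNReal.ofReal (8 * s * K * (4 * R⁻¹)) * ENNReal.ofReal M +
          ENNReal.ofReal (8 * s * K * (R⁻¹ * (2 * (K * b)))) := by
        gcongr
    _ = ENNReal.ofReal (A * η + (8 * s * K * (4 * R⁻¹) * M + 8 * s * K * (R⁻¹ * (2 * (K * b))))) := by
        rw [ENNReal.ofReal_add (by positivity) (by positivity), ENNReal.ofReal_add (by positivity) (by positivity),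
          ENNReal.ofReal_mul hA0, ENNReal.ofReal_mul' hM, add_assoc]
    _ ≤ ENNReal.ofReal ε := ENNReal.ofReal_le_ofReal (by rw [hcoef]; linarith)


end Summit.AtomisticToContinuum.HydrodynamicLimit.Theorems.HTheorem

end
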